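import Summits.ResolutionOfSingularities.ResolutionOfSingularities.Theorems.HilbertSamuelEliminationSigmaMaxModificationsCorridor3SigmaBoundaryRuns
import Summits.ResolutionOfSingularities.ResolutionOfSingularities.Theorems.HilbertSamuelEliminationCampaignW42TertiaryStates
import HarnessLib

/-!
# [OURS · L1 W4.2] σE-COMPACTNESS, part 1/2: GOOD STATES of a boundary-threaded σ-run and the run bookkeeping
# (the σE-port of `…CampaignW42TertiaryStates.lean`; cell res-hironaka, LADDER-RESOLUTION rung L; slot W4.2, crux chain w42
# `SigmaMaxModificationsCorridor3` stmt-ResolutionOfSingularities-19249 / crux stmt-…-18506; res-L1-w42-plan-1 RULING v3.14-13 (CW)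
# «(E5) σE-COMPACTNESS» 2026-08-27T10:52:00Z; hand res-D-pv-047 AS res-L1-s46-pv-10; `--supports stmt-ResolutionOfSingularities-19249 --as helper`)

HONEST FRAMING. OURS proof bookkeeping; NOTHING is a statement of H. Hironaka's manuscript [Hironaka2017] nor of Cossart–Jannsen–Saito;
no new named fact — CJS Thm. 3.10 (1) (Bennett–Hironaka–Singh) enters through the tree's PROVED `IsBlowup.hsFun_le_of_isPermissible`
and Thm. 2.33 (3) through the tree's PROVED closedness of `W(≥ ν)` over a field. AI-written; AI review is weaker than expert review.

WHAT IS PORTED (verbatim arguments of res-L1-s42-pv-2's `…CampaignW42TertiaryStates.lean`, the CJS step `IsCanonicalStep R N ν L P C P'`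
replaced by a step `σ.step W hW N ν L P E C P'` of a BOUNDARY-AWARE STRATEGY `σ : StrategyE` (res-L1-type-o1 p523041), the CJS runs by the
boundary-threaded runs `IsRunFromσE` (p523856), the functional oracle by `StrategyE.IsFunctional` (p523041)):

* `RunTerminatesσE` / `RunInfiniteσE` (from the initial state with boundary `E₀`);
* `StrategyE.StepsOnlyWhileNonempty N ν σ` — σ allows a step only while the `ν`-stratum is non-empty (the ONE property of CJS steps,
  `IsCanonicalStep.hsStratum_nonempty`, that a general σ must be ASKED for; PROVED for `StrategyE.ofStageOracleE ω` and for the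
  boundary-blind lift of every `Strategy.ofStageOracle ω`, hence of `Strategy.cjs R`);
* `StateGoodσE k σ N ν W hW L P E` — the data carried along: `W` of finite type over `k`, `dim W ≤ N`, `ν` never exceeded, every σ-run
  from the state has PERMISSIBLE centres; consequences `isLocallyNoetherian`, `isNoetherian`, `isExcellent`, `isClosed_hsStratum`,
  `isPermissible`, `hsFun_le` (CJS 3.10 (1)), `next` (good states PROPAGATE along σ-steps), `base_mem_hsStratum`;
* run lemmas: `IsRunFromσE.eq_of_length_eq` (functional σ: runs of a given length are unique), `exists_eq_cons_of_runσE`,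
  `exists_runσE_pred_of_runσE_succ`, `exists_stateGoodσE_top_of_runσE`, `hsStratum_top_nonempty_of_runsσE`.

Part 2/2 (`…Corridor3SigmaBoundaryCompactness.lean`) draws the infinite CLOSED marked σE-near chain out of an infinite σE-run.

## References (context)

* V. Cossart, U. Jannsen, S. Saito, LNM 2270 (2020), Rem. 6.29 (1), Thm. 2.33, Thm. 3.10 (1). [CossartJannsenSaito2020]
-/

noncomputable section

set_option linter.dupNamespace false -- mandated namespace of this single-conjunct summit

open CategoryTheory AlgebraicGeometry TopologicalSpace Topology
open Summit.ResolutionOfSingularities.ResolutionOfSingularities.Theorems.CampaignW42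
open Literature.AlgebraicGeometry.Resolution Literature.RingTheory.HilbertSamuel
open Literature.AlgebraicGeometry.CossartJannsenSaito2020

namespace Summit.ResolutionOfSingularities.ResolutionOfSingularities.Theorems.SigmaMaxModificationsCorridor3.Sigma

universe u

variable {σ : StrategyE.{u}} {N : ℕ} {ν : ℕ → ℕ}
variable {k : Type u} [Field k]

/-! ## §1. Termination / infinitude of boundary-threaded runs; «steps only while the stratum is non-empty» -/

/-- [OURS · L1 W4.2] **The boundary-threaded σ-run from `X` (initial boundary `E₀`) TERMINATES**: some σE-run from the initial state ends
with an empty `ν`-stratum. [folklore] -/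
def RunTerminatesσE (σ : StrategyE.{u}) (N : ℕ) (ν : ℕ → ℕ) (X : Scheme.{u}) [IsLocallyNoetherian X] (E₀ : Boundary X) : Prop :=
  ∃ s : CentreSeq X, IsRunσE σ N ν E₀ s ∧ Scheme.hsStratum s.top N ν = ∅

/-- [OURS · L1 W4.2] **The boundary-threaded σ-runs from `X` go on for ever**: σE-runs of every length from the initial state.
[folklore] -/
def RunInfiniteσE (σ : StrategyE.{u}) (N : ℕ) (ν : ℕ → ℕ) (X : Scheme.{u}) [IsLocallyNoetherian X] (E₀ : Boundary X) : Prop :=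
  ∀ n : ℕ, ∃ s : CentreSeq X, IsRunσE σ N ν E₀ s ∧ s.length = n

/-- [OURS · L1 W4.2] **σ STEPS ONLY WHILE THE `ν`-STRATUM IS NON-EMPTY** (the property `IsCanonicalStep.hsStratum_nonempty` of CJS steps,
asked of a general boundary-aware strategy). [folklore] -/
def StrategyE.StepsOnlyWhileNonempty (N : ℕ) (ν : ℕ → ℕ) (σ : StrategyE.{u}) : Prop :=
  ∀ (W : Scheme.{u}) (hW : IsLocallyNoetherian W) (L : Labelling W) (P : Option (Pending W)) (E : Boundary W)
    (C : W.IdealSheafData) (P' : Option (Pending (blowup C))), σ.step W hW N ν L P E C P' → (Scheme.hsStratum W N ν).Nonempty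

/-- A step of a boundary-aware stage oracle happens only while the stratum is non-empty (between cycles the least non-empty label
exists; inside a cycle it is the first conjunct). [cite: CossartJannsenSaito2020, Rem. 6.29 (1)] -/
theorem IsCanonicalStepΩE.hsStratum_nonempty {W : Scheme.{u}} {ω : StageOracleE.{u}} {hW : IsLocallyNoetherian W}
    {L : Labelling W} {E : Boundary W} {P : Option (Pending W)} {C : W.IdealSheafData} {P' : Option (Pending (blowup C))}
    (h : IsCanonicalStepΩE ω hW N ν L E P C P') : (Scheme.hsStratum W N ν).Nonempty := by
  cases P with
  | none =>
    obtain ⟨j, hj, -⟩ := h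
    exact (L.exists_part_nonempty_iff _).mp ⟨j, hj.1⟩
  | some P => exact h.1

/-- The strategy of a boundary-aware stage oracle steps only while the stratum is non-empty. [folklore] -/
theorem StrategyE.stepsOnlyWhileNonempty_ofStageOracleE (ω : StageOracleE.{u}) (N : ℕ) (ν : ℕ → ℕ) :
    (StrategyE.ofStageOracleE ω).StepsOnlyWhileNonempty N ν :=
  fun _ _ _ _ _ _ _ h => IsCanonicalStepΩE.hsStratum_nonempty h

/-- The boundary-blind lift of the strategy of a stage oracle steps only while the stratum is non-empty — in particular
`(Strategy.cjs R).withBoundary` does. [folklore] -/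
theorem StrategyE.stepsOnlyWhileNonempty_withBoundary_ofStageOracle (ω : StageOracle.{u}) (N : ℕ) (ν : ℕ → ℕ) :
    (Strategy.ofStageOracle ω).withBoundary.StepsOnlyWhileNonempty N ν :=
  fun _ _ _ _ _ _ _ h => IsCanonicalStepΩ.hsStratum_nonempty h

/-! ## §2. Good states of a boundary-threaded σ-run -/

/-- [OURS · L1 W4.2] THE DATA CARRIED ALONG A σE-RUN at a state `(W, L, P, E)`: `W` of finite type over the ground field `k`, `dim W ≤ N`,
`ν` never exceeded by `H^N_W` (so `W(ν) = W(≥ ν)` is closed), and every boundary-threaded σ-run from the state has PERMISSIBLE centres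
(CJS Def. 3.1; for an admissible σ this is clause (a)(i) along the run). σE-port of `CampaignW42.StateGood`. OURS bookkeeping; NOT a
statement of the manuscript. [folklore] -/
structure StateGoodσE (k : Type u) [Field k] (σ : StrategyE.{u}) (N : ℕ) (ν : ℕ → ℕ) (W : Scheme.{u})
    (hW : IsLocallyNoetherian W) (L : Labelling W) (P : Option (Pending W)) (E : Boundary W) : Prop where
  /-- `W` is of finite type over `k` -/
  overField : ∃ f : W ⟶ Spec (.of k), LocallyOfFiniteType f ∧ QuasiCompact f
  /-- the level bounds the dimension -/
  dim_le : topologicalKrullDim W ≤ (N : WithBot ℕ∞)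
  /-- `ν` is never exceeded -/
  supMax : ∀ w : W, ν ≤ Scheme.hsFun W N w → Scheme.hsFun W N w = ν
  /-- the centres of all σE-runs from the state are permissible -/
  permRuns : ∀ t : CentreSeq W, IsRunFromσE σ N ν hW L P E t → t.AllPermissible

namespace StateGoodσE

variable {W : Scheme.{u}} {hW : IsLocallyNoetherian W} {L : Labelling W} {P : Option (Pending W)} {E : Boundary W}

/-- A good state is Noetherian. [folklore] -/
theorem isNoetherian (h : StateGoodσE k σ N ν W hW L P E) : IsNoetherian W := by
  obtain ⟨f, hf, hq⟩ := h.overField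
  exact Scheme.isNoetherian_of_finiteType_over_field f

/-- A good state is excellent. [cite: StacksProject, Tag 07QW] -/
theorem isExcellent (h : StateGoodσE k σ N ν W hW L P E) : Scheme.IsExcellent W := by
  obtain ⟨f, hf, -⟩ := h.overField
  exact Scheme.isExcellent_of_locallyOfFiniteType Stacks07QW_field_holds f

/-- At a good state the `ν`-stratum is closed. [cite: CossartJannsenSaito2020, Lemma 2.36 (a)] -/
theorem isClosed_hsStratum (h : StateGoodσE k σ N ν W hW L P E) : IsClosed (Scheme.hsStratum W N ν) := by
  obtain ⟨f, hf, hq⟩ := h.overField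
  rw [hsStratum_eq_hsStratumGE_of_supMax h.supMax]
  exact isClosed_hsStratumGE_over_field f h.dim_le ν

/-- The centre of a σ-step from a good state is permissible. [folklore] -/
theorem isPermissible (h : StateGoodσE k σ N ν W hW L P E) {C : W.IdealSheafData} {P' : Option (Pending (blowup C))}
    (hst : σ.step W hW N ν L P E C P') : IdealSheafData.IsPermissible C :=
  ((CentreSeq.allPermissible_cons C (CentreSeq.nil _)).mp
    (h.permRuns (CentreSeq.cons C (CentreSeq.nil _)) ⟨P', hst, trivial⟩)).1

/-- `H^N` does not increase along a σ-step from a good state (CJS Thm. 3.10 (1) for the permissible centre of the step).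
[cite: CossartJannsenSaito2020, Thm. 3.10 (1)] -/
theorem hsFun_le (h : StateGoodσE k σ N ν W hW L P E) {C : W.IdealSheafData} {P' : Option (Pending (blowup C))}
    (hst : σ.step W hW N ν L P E C P') (z : ↥(blowup C)) :
    Scheme.hsFun (blowup C) N z ≤ Scheme.hsFun W N ((blowup.π C).base z) := by
  haveI := hW
  exact (blowup.isBlowup C).hsFun_le_of_isPermissible h.isExcellent (h.isPermissible hst) N z

/-- **Good states propagate along σ-steps** (boundary threaded by `E.next C`). [folklore] -/
theorem next (h : StateGoodσE k σ N ν W hW L P E) {C : W.IdealSheafData} {P' : Option (Pending (blowup C))}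
    (hst : σ.step W hW N ν L P E C P') :
    StateGoodσE k σ N ν (blowup C) (isLocallyNoetherian_blowup hW C) (L.next (Scheme.hsStratum W N ν) C) P' (E.next C) := by
  haveI := hW
  haveI : IsProper (blowup.π C) := (blowup.isBlowup C).isProper
  obtain ⟨f, hf, hq⟩ := h.overField
  refine ⟨⟨blowup.π C ≫ f, inferInstance, inferInstance⟩,
    (blowup.isBlowup C).topologicalKrullDim_le_of_isLocallyNoetherian h.dim_le, fun z hz => ?_, fun t ht => ?_⟩
  · have hle := h.hsFun_le hst z
    have heq := h.supMax _ (hz.trans hle)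
    exact le_antisymm (heq ▸ hle) hz
  · exact ((CentreSeq.allPermissible_cons C t).mp (h.permRuns (CentreSeq.cons C t) ⟨P', hst, ht⟩)).2

/-- A stratum point upstairs of a σ-step from a good state lies over a stratum point. [folklore] -/
theorem base_mem_hsStratum (h : StateGoodσE k σ N ν W hW L P E) {C : W.IdealSheafData}
    {P' : Option (Pending (blowup C))} (hst : σ.step W hW N ν L P E C P') {z : ↥(blowup C)}
    (hz : z ∈ Scheme.hsStratum (blowup C) N ν) : (blowup.π C).base z ∈ Scheme.hsStratum W N ν :=
  h.supMax _ ((Scheme.mem_hsStratum_iff.mp hz).symm.le.trans (h.hsFun_le hst z))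

end StateGoodσE

/-! ## §3. Runs from a state: uniqueness (functional σ), first-step decomposition, last-step bookkeeping -/

/-- **Two σE-runs of the same length from the same state coincide** (functional σ). [folklore] -/
theorem IsRunFromσE.eq_of_length_eq (hσ : σ.IsFunctional N ν) :
    ∀ {W : Scheme.{u}} (hW : IsLocallyNoetherian W) (L : Labelling W) (P : Option (Pending W)) (E : Boundary W)
      {s₁ s₂ : CentreSeq W}, IsRunFromσE σ N ν hW L P E s₁ → IsRunFromσE σ N ν hW L P E s₂ →
        s₁.length = s₂.length → s₁ = s₂
  | W, hW, L, P, E, CentreSeq.nil _, s₂, _, _, hlen => by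
    cases s₂ with
    | nil _ => rfl
    | cons C r => simp at hlen
  | W, hW, L, P, E, CentreSeq.cons C₁ r₁, s₂, h₁, h₂, hlen => by
    cases s₂ with
    | nil _ => simp at hlen
    | cons C₂ r₂ =>
      obtain ⟨P₁, hs₁, hr₁⟩ := h₁
      obtain ⟨P₂, hs₂, hr₂⟩ := h₂
      obtain rfl : C₁ = C₂ := (hσ W hW L P E).1 _ _ _ _ hs₁ hs₂
      obtain rfl : P₁ = P₂ := (hσ W hW L P E).2 _ _ _ hs₁ hs₂
      simp only [CentreSeq.length_cons, Nat.add_right_cancel_iff] at hlen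
      rw [IsRunFromσE.eq_of_length_eq hσ _ _ _ _ hr₁ hr₂ hlen]

/-- For a functional σ, a σE-run of positive length from `(L, P, E)` begins with THE step σ allows there. [folklore] -/
theorem exists_eq_cons_of_runσE (hσ : σ.IsFunctional N ν) {W : Scheme.{u}} {hW : IsLocallyNoetherian W} {L : Labelling W}
    {P : Option (Pending W)} {E : Boundary W} {C : W.IdealSheafData} {P' : Option (Pending (blowup C))}
    (hst : σ.step W hW N ν L P E C P') {t : CentreSeq W} (ht : IsRunFromσE σ N ν hW L P E t) {m : ℕ}
    (hlen : t.length = m + 1) :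
    ∃ rest : CentreSeq (blowup C), t = CentreSeq.cons C rest ∧
      IsRunFromσE σ N ν (isLocallyNoetherian_blowup hW C) (L.next (Scheme.hsStratum W N ν) C) P' (E.next C) rest ∧
        rest.length = m := by
  cases t with
  | nil _ => simp at hlen
  | cons C₁ rest =>
    obtain ⟨P₁, hst₁, hrest⟩ := ht
    obtain rfl : C₁ = C := (hσ W hW L P E).1 _ _ _ _ hst₁ hst
    obtain rfl : P₁ = P' := (hσ W hW L P E).2 _ _ _ hst₁ hst
    exact ⟨rest, rfl, hrest, by simpa using hlen⟩

/-- **LAST-STEP BOOKKEEPING**: along σE-runs from a good state, every stratum point at depth `m + 1` lies over a stratum point at depth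
`m` (with the same image at depth `0`). [folklore] -/
theorem exists_runσE_pred_of_runσE_succ (m : ℕ) :
    ∀ {W : Scheme.{u}} {hW : IsLocallyNoetherian W} {L : Labelling W} {P : Option (Pending W)} {E : Boundary W},
      StateGoodσE k σ N ν W hW L P E →
      ∀ (t' : CentreSeq W), IsRunFromσE σ N ν hW L P E t' → t'.length = m + 1 →
      ∀ z' : t'.top, z' ∈ Scheme.hsStratum t'.top N ν →
        ∃ (t : CentreSeq W), IsRunFromσE σ N ν hW L P E t ∧ t.length = m ∧
          ∃ z : t.top, z ∈ Scheme.hsStratum t.top N ν ∧ t.comp.base z = t'.comp.base z' := by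
  induction m with
  | zero =>
    intro W hW L P E hgood t' ht' hlen z' hz'
    cases t' with
    | nil _ => simp at hlen
    | cons C rest =>
      obtain ⟨P', hst, hrest⟩ := ht'
      cases rest with
      | cons _ _ => simp at hlen
      | nil _ =>
        exact ⟨CentreSeq.nil W, trivial, rfl, (blowup.π C).base z', hgood.base_mem_hsStratum hst hz', rfl⟩
  | succ m ih =>
    intro W hW L P E hgood t' ht' hlen z' hz'
    cases t' with
    | nil _ => simp at hlen
    | cons C r' =>
      obtain ⟨P', hst, hr'⟩ := ht'
      have hlen' : r'.length = m + 1 := by simpa using hlen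
      obtain ⟨r, hr, hrlen, z, hz, hzeq⟩ := ih (hgood.next hst) r' hr' hlen' z' hz'
      refine ⟨CentreSeq.cons C r, ⟨P', hst, hr⟩, by simp [hrlen], z, hz, ?_⟩
      show (blowup.π C).base (r.comp.base z) = (blowup.π C).base (r'.comp.base z')
      rw [hzeq]

/-- Along a σE-run from a good state the top carries a good state. [folklore] -/
theorem exists_stateGoodσE_top_of_runσE (m : ℕ) :
    ∀ {W : Scheme.{u}} {hW : IsLocallyNoetherian W} {L : Labelling W} {P : Option (Pending W)} {E : Boundary W},
      StateGoodσE k σ N ν W hW L P E →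
      ∀ t : CentreSeq W, IsRunFromσE σ N ν hW L P E t → t.length = m →
        ∃ (hW' : IsLocallyNoetherian t.top) (L' : Labelling t.top) (P' : Option (Pending t.top)) (E' : Boundary t.top),
          StateGoodσE k σ N ν t.top hW' L' P' E' := by
  induction m with
  | zero =>
    intro W hW L P E hg t ht hlen
    cases t with
    | nil _ => exact ⟨hW, L, P, E, hg⟩
    | cons _ _ => simp at hlen
  | succ m ih =>
    intro W hW L P E hg t ht hlen
    cases t with
    | nil _ => simp at hlen
    | cons C rest =>
      obtain ⟨Q, hst, hrest⟩ := ht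
      exact ih (hg.next hst) rest hrest (by simpa using hlen)

/-- Stratum points at depth `m` from a state with runs of every length: the top stratum of a run is non-empty, PROVIDED σ steps only
while the stratum is non-empty. [cite: CossartJannsenSaito2020, Rem. 6.29 (1)] -/
theorem hsStratum_top_nonempty_of_runsσE (hσ : σ.IsFunctional N ν) (hne : σ.StepsOnlyWhileNonempty N ν) (m : ℕ) :
    ∀ {W : Scheme.{u}} (hW : IsLocallyNoetherian W) (L : Labelling W) (P : Option (Pending W)) (E : Boundary W)
      (t : CentreSeq W), IsRunFromσE σ N ν hW L P E t → t.length = m →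
      (∃ t' : CentreSeq W, IsRunFromσE σ N ν hW L P E t' ∧ t'.length = m + 1) →
        (Scheme.hsStratum t.top N ν).Nonempty := by
  induction m with
  | zero =>
    intro W hW L P E t ht hlen ⟨t', ht', hlen'⟩
    cases t with
    | cons _ _ => simp at hlen
    | nil _ =>
      cases t' with
      | nil _ => simp at hlen'
      | cons C rest =>
        obtain ⟨P', hst, -⟩ := ht'
        exact hne _ _ _ _ _ _ _ hst
  | succ m ih =>
    intro W hW L P E t ht hlen ⟨t', ht', hlen'⟩
    cases t with
    | nil _ => simp at hlen
    | cons C rest =>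
      obtain ⟨P', hst, hrest⟩ := ht
      obtain ⟨rest', rfl, hrest', hlen''⟩ := exists_eq_cons_of_runσE hσ hst ht' hlen'
      exact ih _ _ _ _ rest hrest (by simpa using hlen) ⟨rest', hrest', hlen''⟩

end Summit.ResolutionOfSingularities.ResolutionOfSingularities.Theorems.SigmaMaxModificationsCorridor3.Sigma

end
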